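import Literature.Probability.LatticeModels.DyadicVelocityWalk
import Literature.Probability.LatticeModels.SparseMeetingTails
import Mathlib.MeasureTheory.Measure.Count
import HarnessLib

/-!
# Two independent dyadic-velocity paths rarely travel together: exponential tails for the
# number of near-meetings

The probabilistic input of the path measures in Garban–Spencer's proof of long-range order
(arXiv:2109.01617, Theorem 2.4, after Benjamini–Pemantle–Peres, Ann. Probab. 26 (1998),
Theorem 1.3 / Lemma 3.1): for the explicit lazy walks of `DyadicVelocityWalk` we consider the
randomness `PEnv K m` of ONE lattice path (two independent walks, one for each random transverse
axis) and two independent paths `p = (ω, ω')`.  A **near-meeting** at time `τ` is the event that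
both transverse lattice positions of the two paths differ by at most `4` (this is what a shared
lattice edge forces, see `BallPathOverlap`).  We prove, uniformly in the horizon `m ≤ 2^K`, an
exponential tail for the number of near-meeting times in `[0, m]` under the uniform (counting)
measure on pairs (`card_meetCount_ge_le`):

  `#{(ω, ω') : #{τ ≤ m : near-meeting at τ} ≥ k} ≤ (1/2)^{⌊(k−1)/L⌋} · #(pairs)`

for an absolute constant `L`.  Mechanism (`SparseMeetingTails`): the filtration `ℱ s` of events
invariant under resampling every variable whose block starts at or after `s`; the meeting event at
time `t` is in `ℱ t` (locality of the walk); and the **decoupling inequality**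
`#(E ∩ M(s+r)) ≤ g(r) #E` for `E ∈ ℱ s` with `g(r) = 6400 (4/9)^{⌊log₂ r⌋ − 1}` (`r ≥ 4`), by
counting along the two fresh variables of the first path (`card_fiber_freshCoord_le`: each is hit
by at most `9N/κ + 1 ≤ 10(N+1)/κ` of its `N + 1` values, `κ = (3/2)^{i⋆}/8`); the dyadic shells
give `∑_{r ≥ 2^{I+1}} g(r) ≤ 115200 (8/9)^I`, which is `≤ 1/2` for a suitable absolute `I`.

## References

* I. Benjamini, R. Pemantle, Y. Peres, Ann. Probab. 26 (1998) 1198–1211 = arXiv:math/9701227,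
  §3 (Lemma 3.1, proof of Theorem 1.3). [BenjaminiPemantlePeres1998]
* C. Garban, T. Spencer, arXiv:2109.01617, Theorem 2.4 and Step 2 of the proof of Theorem 1.3.
  [GarbanSpencer2022]
-/

noncomputable section

open Finset MeasureTheory Set
open scoped BigOperators ENNReal

namespace Literature.Probability.LatticeModels

namespace DyadicWalk

variable {K m : ℕ}

/-! ### One path's randomness, the pair space, near-meetings -/

/-- The randomness of one lattice path: a grid value for every (transverse axis, block). [folklore] -/
abbrev PEnv (K m : ℕ) : Type := Fin 2 × Coord K m → Fin (gridN K + 1)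

/-- The walk driving the transverse axis `a`. [folklore] -/
def walk (ω : PEnv K m) (a : Fin 2) : Env K m := fun c => ω (a, c)

/-- The lattice position `S_a(t)` of the transverse axis `a` at time `t`. [folklore] -/
def S (ω : PEnv K m) (a : Fin 2) (t : ℕ) : ℤ := ipos (walk ω a) t

/-- Updating the variable `(a, c)` updates the walk of axis `a` and leaves the other walk
unchanged. [folklore] -/
theorem walk_update (ω : PEnv K m) (a a' : Fin 2) (c : Coord K m) (v : Fin (gridN K + 1)) :
    walk (Function.update ω (a, c) v) a' =
      if a' = a then Function.update (walk ω a) c v else walk ω a' := by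
  funext c'
  unfold walk
  split_ifs with h
  · subst h
    by_cases hc : c' = c
    · subst hc; simp
    · rw [Function.update_of_ne (fun e => hc (congrArg Prod.snd e)), Function.update_of_ne hc]
  · rw [Function.update_of_ne (fun e => h (congrArg Prod.fst e))]

/-- Resampling a variable whose block starts at or after `t` does not move `S_a(t)`. [folklore] -/
theorem S_update_of_le (ω : PEnv K m) (a a' : Fin 2) {c : Coord K m} {t : ℕ} (hc : t ≤ start c)
    (v : Fin (gridN K + 1)) : S (Function.update ω (a, c) v) a' t = S ω a' t := by
  unfold S
  rw [walk_update]
  split_ifs with h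
  · subst h; exact ipos_update_of_le _ hc v
  · rfl

/-- Resampling a variable of the other axis does not move `S_a`. [folklore] -/
theorem S_update_of_ne (ω : PEnv K m) {a a' : Fin 2} (h : a' ≠ a) (c : Coord K m) (t : ℕ)
    (v : Fin (gridN K + 1)) : S (Function.update ω (a, c) v) a' t = S ω a' t := by
  unfold S
  rw [walk_update, if_neg h]

/-- Along its own axis, resampling acts on the walk. [folklore] -/
theorem S_update_self (ω : PEnv K m) (a : Fin 2) (c : Coord K m) (t : ℕ) (v : Fin (gridN K + 1)) :
    S (Function.update ω (a, c) v) a t = ipos (Function.update (walk ω a) c v) t := by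
  unfold S
  rw [walk_update, if_pos rfl]

/-- The **pair space**: two independent paths. [folklore] -/
abbrev Pair (K m : ℕ) : Type := PEnv K m × PEnv K m

/-- The **near-meeting** event at time `τ`: both transverse lattice positions of the two paths
differ by at most `4`. [folklore] -/
def meet (K m τ : ℕ) : Set (Pair K m) := {p | ∀ a : Fin 2, |S p.1 a τ - S p.2 a τ| ≤ 4}

/-- The meeting events with the horizon `m` built in (empty beyond it). [folklore] -/
def M (K m : ℕ) (t : ℕ) : Set (Pair K m) := if t ≤ m then meet K m t else ∅

/-! ### The filtration of resampling-invariant events -/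

/-- `E` is **invariant from time `s` on**: resampling any variable (of either path) whose block
starts at or after `s` does not change membership in `E`. [folklore] -/
def InvariantFrom (s : ℕ) (E : Set (Pair K m)) : Prop :=
  ∀ (a : Fin 2) (c : Coord K m), s ≤ start c → ∀ (p : Pair K m) (v : Fin (gridN K + 1)),
    (p ∈ E ↔ (Function.update p.1 (a, c) v, p.2) ∈ E) ∧
    (p ∈ E ↔ (p.1, Function.update p.2 (a, c) v) ∈ E)

/-- **The filtration** `ℱ s`: the σ-algebra of events invariant from time `s` on ("determined by
the variables of blocks starting before `s`"). [folklore] -/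
@[reducible] def filt (K m s : ℕ) : MeasurableSpace (Pair K m) where
  MeasurableSet' := InvariantFrom s
  measurableSet_empty := fun _ _ _ _ _ => ⟨Iff.rfl, Iff.rfl⟩
  measurableSet_compl := fun E hE a c hc p v =>
    ⟨not_congr (hE a c hc p v).1, not_congr (hE a c hc p v).2⟩
  measurableSet_iUnion := fun E hE a c hc p v =>
    ⟨by simp only [Set.mem_iUnion]; exact exists_congr fun i => (hE i a c hc p v).1,
     by simp only [Set.mem_iUnion]; exact exists_congr fun i => (hE i a c hc p v).2⟩

/-- Membership in `ℱ s` is invariance from `s` on. [folklore] -/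
theorem measurableSet_filt_iff {s : ℕ} {E : Set (Pair K m)} :
    MeasurableSet[filt K m s] E ↔ InvariantFrom s E := Iff.rfl

/-- The filtration is increasing. [folklore] -/
theorem filt_mono (K m : ℕ) : Monotone (filt K m) := by
  intro s s' hss' E hE
  exact fun a c hc p v => hE a c (hss'.trans hc) p v

/-- **The meeting event at time `t` is an `ℱ_t`-event** (locality of the walks). [folklore] -/
theorem measurableSet_filt_M (t : ℕ) : MeasurableSet[filt K m t] (M K m t) := by
  rw [measurableSet_filt_iff]
  intro a c hc p v
  by_cases ht : t ≤ m
  · simp [M, if_pos ht, meet, S_update_of_le _ _ _ hc]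
  · simp [M, if_neg ht]

/-! ### Counting along one resampled variable -/

open Classical in
/-- The number of pairs in an event. [folklore] -/
def cnt (E : Set (Pair K m)) : ℕ := #{p : Pair K m | p ∈ E}

/-- The counting measure (all sets measurable) of an event is `cnt`. [folklore] -/
theorem count_eq_cnt (E : Set (Pair K m)) :
    @Measure.count (Pair K m) ⊤ E = (cnt E : ℝ≥0∞) := by
  classical
  rw [@Measure.count_apply_finite' (Pair K m) ⊤ E (Set.toFinite E) MeasurableSpace.measurableSet_top]
  unfold cnt
  congr 2
  ext p
  simp

/-- `cnt` is monotone. [folklore] -/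
theorem cnt_mono {E F : Set (Pair K m)} (h : E ⊆ F) : cnt E ≤ cnt F := by
  classical
  unfold cnt
  exact Finset.card_le_card (fun p hp => by
    simp only [Finset.mem_filter, Finset.mem_univ, true_and] at hp ⊢; exact h hp)

/-- `cnt ∅ = 0`. [folklore] -/
@[simp] theorem cnt_empty : cnt (∅ : Set (Pair K m)) = 0 := by
  classical
  unfold cnt; simp

open Classical in
/-- **Fibre counting along one variable of the first path.** If `E` is invariant under
resampling the variable `c₀` of the first path, and along that variable the event `M'` is hit by
at most `B` of the `N + 1` values (whatever everything else is), then
`#(E ∩ M') · (N+1) ≤ B · #E`. [folklore] -/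
theorem cnt_inter_mul_le (c₀ : Fin 2 × Coord K m) (E M' : Set (Pair K m))
    (hE : ∀ (p : Pair K m) (v : Fin (gridN K + 1)), p ∈ E ↔ (Function.update p.1 c₀ v, p.2) ∈ E)
    {B : ℝ} (hB : ∀ q : Pair K m,
      (#{v : Fin (gridN K + 1) | (Function.update q.1 c₀ v, q.2) ∈ M'} : ℝ) ≤ B) :
    (cnt (E ∩ M') : ℝ) * (gridN K + 1) ≤ B * cnt E := by
  -- normalisation map and its fibres
  set ρ : Pair K m → Pair K m := fun p => (Function.update p.1 c₀ 0, p.2) with hρ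
  have hB0 : 0 ≤ B := le_trans (Nat.cast_nonneg _) (hB ((fun _ => 0), (fun _ => 0)))
  have fibE : cnt (E ∩ M') = ∑ q : Pair K m, #{p : Pair K m | p ∈ E ∩ M' ∧ ρ p = q} := by
    unfold cnt
    rw [Finset.card_eq_sum_card_fiberwise (f := ρ) (t := Finset.univ) (fun _ _ => Finset.mem_univ _)]
    refine Finset.sum_congr rfl fun q _ => ?_
    congr 1; ext p; simp [and_assoc]
  have fibE' : cnt E = ∑ q : Pair K m, #{p : Pair K m | p ∈ E ∧ ρ p = q} := by
    unfold cnt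
    rw [Finset.card_eq_sum_card_fiberwise (f := ρ) (t := Finset.univ) (fun _ _ => Finset.mem_univ _)]
    refine Finset.sum_congr rfl fun q _ => ?_
    congr 1; ext p; simp
  rw [fibE, fibE', Nat.cast_sum, Nat.cast_sum, Finset.sum_mul, Finset.mul_sum]
  refine Finset.sum_le_sum fun q _ => ?_
  -- per-fibre inequality
  set ψ : Fin (gridN K + 1) → Pair K m := fun v => (Function.update q.1 c₀ v, q.2) with hψ
  have hψinj : Function.Injective ψ := by
    intro v w h
    have := congrArg (fun p : Pair K m => p.1 c₀) h
    simpa [hψ] using this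
  have hψρ : ∀ p : Pair K m, ρ p = q → ψ (p.1 c₀) = p := by
    intro p hp
    have hp' : (Function.update p.1 c₀ 0, p.2) = q := hp
    have h1 : Function.update p.1 c₀ 0 = q.1 := by rw [← hp']
    have h2 : p.2 = q.2 := by rw [← hp']
    show (Function.update q.1 c₀ (p.1 c₀), q.2) = p
    ext1
    · show Function.update q.1 c₀ (p.1 c₀) = p.1
      rw [← h1, Function.update_idem, Function.update_eq_self]
    · exact h2.symm
  rcases (Finset.univ.filter (fun p : Pair K m => p ∈ E ∩ M' ∧ ρ p = q)).eq_empty_or_nonempty with h0 | ⟨p₀, hp₀⟩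
  · rw [h0, Finset.card_empty, Nat.cast_zero, zero_mul]
    exact mul_nonneg hB0 (Nat.cast_nonneg _)
  · simp only [Finset.mem_filter, Finset.mem_univ, true_and] at hp₀
    obtain ⟨⟨hpE, -⟩, hpq⟩ := hp₀
    have hpq' : (Function.update p₀.1 c₀ 0, p₀.2) = q := hpq
    have hq1 : q.1 c₀ = 0 := by rw [← hpq']; simp
    have hqE : q ∈ E := by
      have := (hE p₀ 0).1 hpE
      rwa [hpq'] at this
    have hρψ : ∀ v, ρ (ψ v) = q := by
      intro v
      show (Function.update (Function.update q.1 c₀ v) c₀ 0, q.2) = q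
      rw [Function.update_idem, Function.update_eq_self_iff.2 hq1.symm]
    -- (a) the `E ∩ M'`-fibre injects into the good values of the variable
    have ha : #{p : Pair K m | p ∈ E ∩ M' ∧ ρ p = q} ≤
        #{v : Fin (gridN K + 1) | (Function.update q.1 c₀ v, q.2) ∈ M'} := by
      refine Finset.card_le_card_of_injOn (fun p => p.1 c₀) (fun p hp => ?_) (fun p hp p' hp' h => ?_)
      · simp only [Finset.coe_filter, Finset.mem_univ, true_and, Set.mem_setOf_eq] at hp ⊢
        have := hψρ p hp.2
        rw [hψ] at this
        simp only at this
        rw [this]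
        exact hp.1.2
      · simp only [Finset.coe_filter, Finset.mem_univ, true_and, Set.mem_setOf_eq] at hp hp'
        simp only at h
        rw [← hψρ p hp.2, ← hψρ p' hp'.2, h]
    -- (b) all `N + 1` resamplings of `q` lie in the `E`-fibre
    have hb : gridN K + 1 ≤ #{p : Pair K m | p ∈ E ∧ ρ p = q} := by
      have : #(Finset.univ.image ψ) = gridN K + 1 := by
        rw [Finset.card_image_of_injective _ hψinj, Finset.card_univ, Fintype.card_fin]
      refine this.symm.le.trans (Finset.card_le_card fun p hp => ?_)
      rw [Finset.mem_image] at hp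
      obtain ⟨v, -, rfl⟩ := hp
      simp only [Finset.mem_filter, Finset.mem_univ, true_and]
      refine ⟨?_, hρψ v⟩
      have := (hE q v).1 hqE
      exact this
    calc (#{p : Pair K m | p ∈ E ∩ M' ∧ ρ p = q} : ℝ) * (gridN K + 1)
        ≤ B * (gridN K + 1) := by
          refine mul_le_mul_of_nonneg_right (le_trans ?_ (hB q)) (by positivity)
          exact_mod_cast ha
      _ ≤ B * #{p : Pair K m | p ∈ E ∧ ρ p = q} := by
          refine mul_le_mul_of_nonneg_left ?_ hB0
          exact_mod_cast hb

/-! ### The decoupling inequality -/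

/-- The one-axis meeting event at time `T`. [folklore] -/
def meetAxis (K m : ℕ) (a : Fin 2) (T : ℕ) : Set (Pair K m) := {p | |S p.1 a T - S p.2 a T| ≤ 4}

/-- `meet = meetAxis 0 ∩ meetAxis 1`. [folklore] -/
theorem meet_eq_inter (T : ℕ) : meet K m T = meetAxis K m 0 T ∩ meetAxis K m 1 T := by
  ext p
  simp only [meet, meetAxis, Set.mem_setOf_eq, Set.mem_inter_iff, Fin.forall_fin_two]

open Classical in
/-- The fibre bound for a one-axis meeting event along the fresh variable of that axis.
[cite: BenjaminiPemantlePeres1998, §3 (predictability profile)] -/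
theorem card_fiber_meetAxis_le (hK : m ≤ 2 ^ K) {s r : ℕ} (hr : 4 ≤ r) (hsr : s + r ≤ m)
    (a : Fin 2) (q : Pair K m) :
    (#{v : Fin (gridN K + 1) |
        (Function.update q.1 (a, freshCoord K m s r) v, q.2) ∈ meetAxis K m a (s + r)} : ℝ) ≤
      9 * gridN K / kappa r + 1 := by
  have h := card_fiber_freshCoord_le hr hsr hK (walk q.1 a) (S q.2 a (s + r))
  refine le_trans (le_of_eq ?_) h
  congr 2
  ext v
  simp only [Finset.mem_filter, Finset.mem_univ, true_and, meetAxis, Set.mem_setOf_eq, S_update_self]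

/-- **The decoupling inequality (counting form).** For `r ≥ 4`, `s + r ≤ m ≤ 2^K` and an event
`E` invariant from time `s` on,
`#(E ∩ {near-meeting at s + r}) ≤ 6400 · (4/9)^{i⋆(r)} · #E`: resample the two fresh variables
of the first path one after the other (`cnt_inter_mul_le` twice), each hitting the meeting window
for at most `9N/κ + 1 ≤ 10(N+1)/κ` of its `N + 1` values.
[cite: BenjaminiPemantlePeres1998, Lemma 3.1 (variant)] -/
theorem cnt_inter_M_le (hK : m ≤ 2 ^ K) {s r : ℕ} (hr : 4 ≤ r) (hsr : s + r ≤ m)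
    (E : Set (Pair K m)) (hE : InvariantFrom s E) :
    (cnt (E ∩ M K m (s + r)) : ℝ) ≤ 6400 * (4 / 9 : ℝ) ^ freshScale r * cnt E := by
  classical
  set c := freshCoord K m s r with hc_def
  have hc : s ≤ start c := le_start_freshCoord hr hsr hK
  set T := s + r with hT
  have hM : M K m T = meetAxis K m 0 T ∩ meetAxis K m 1 T := by
    rw [M, if_pos hsr, meet_eq_inter]
  set B : ℝ := 9 * gridN K / kappa r + 1 with hB
  have hN : (0 : ℝ) < gridN K := by unfold gridN; positivity
  have hκ := kappa_pos r
  have hκN : kappa r ≤ gridN K := kappa_le_gridN hr (by omega) hK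
  -- step 1: resample the axis-1 fresh variable
  have step1 : (cnt ((E ∩ meetAxis K m 0 T) ∩ meetAxis K m 1 T) : ℝ) * (gridN K + 1) ≤
      B * cnt (E ∩ meetAxis K m 0 T) := by
    refine cnt_inter_mul_le ((1 : Fin 2), c) (E ∩ meetAxis K m 0 T) (meetAxis K m 1 T)
      (fun p v => ?_) (fun q => card_fiber_meetAxis_le hK hr hsr 1 q)
    simp only [Set.mem_inter_iff, meetAxis, Set.mem_setOf_eq]
    rw [S_update_of_ne _ (show (0 : Fin 2) ≠ 1 by decide)]
    exact and_congr_left fun _ => (hE 1 c hc p v).1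
  -- step 2: resample the axis-0 fresh variable
  have step2 : (cnt (E ∩ meetAxis K m 0 T) : ℝ) * (gridN K + 1) ≤ B * cnt E :=
    cnt_inter_mul_le ((0 : Fin 2), c) E (meetAxis K m 0 T) (fun p v => (hE 0 c hc p v).1)
      (fun q => card_fiber_meetAxis_le hK hr hsr 0 q)
  -- combine
  have hB10 : B ≤ 10 * (gridN K + 1) / kappa r := by
    rw [hB, div_add_one hκ.ne', div_le_div_iff_of_pos_right hκ]
    nlinarith
  have hB0 : 0 ≤ B := by rw [hB]; positivity
  have hE0 : (0 : ℝ) ≤ cnt E := Nat.cast_nonneg _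
  have key : (cnt (E ∩ M K m T) : ℝ) * (gridN K + 1) ^ 2 ≤ B ^ 2 * cnt E := by
    rw [hM, ← Set.inter_assoc]
    calc (cnt ((E ∩ meetAxis K m 0 T) ∩ meetAxis K m 1 T) : ℝ) * (gridN K + 1) ^ 2
        = ((cnt ((E ∩ meetAxis K m 0 T) ∩ meetAxis K m 1 T) : ℝ) * (gridN K + 1)) * (gridN K + 1) := by
          ring
      _ ≤ (B * cnt (E ∩ meetAxis K m 0 T)) * (gridN K + 1) :=
          mul_le_mul_of_nonneg_right step1 (by positivity)
      _ = B * ((cnt (E ∩ meetAxis K m 0 T) : ℝ) * (gridN K + 1)) := by ring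
      _ ≤ B * (B * cnt E) := mul_le_mul_of_nonneg_left step2 hB0
      _ = B ^ 2 * cnt E := by ring
  have hratio : B ^ 2 / (gridN K + 1) ^ 2 ≤ 6400 * (4 / 9 : ℝ) ^ freshScale r := by
    have h1 : B / (gridN K + 1) ≤ 10 / kappa r := by
      rw [div_le_div_iff₀ (by positivity) hκ]
      calc B * kappa r ≤ 10 * (gridN K + 1) / kappa r * kappa r :=
            mul_le_mul_of_nonneg_right hB10 hκ.le
        _ = 10 * (↑(gridN K) + 1) := by field_simp
    have h2 : (10 / kappa r) ^ 2 = 6400 * (4 / 9 : ℝ) ^ freshScale r := by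
      rw [kappa_eq]
      have hq : (4 / 9 : ℝ) ^ freshScale r = (((3 / 2 : ℝ) ^ freshScale r) ^ 2)⁻¹ := by
        rw [← pow_mul, mul_comm, pow_mul, ← inv_pow]; norm_num
      have hne : (3 / 2 : ℝ) ^ freshScale r ≠ 0 := by positivity
      rw [hq]
      field_simp
      ring
    rw [← div_pow, ← h2]
    exact pow_le_pow_left₀ (div_nonneg hB0 (by positivity)) h1 2
  calc (cnt (E ∩ M K m T) : ℝ) = (cnt (E ∩ M K m T) : ℝ) * (gridN K + 1) ^ 2 / (gridN K + 1) ^ 2 := by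
        field_simp
    _ ≤ B ^ 2 * cnt E / (gridN K + 1) ^ 2 := div_le_div_of_nonneg_right key (by positivity)
    _ = B ^ 2 / (gridN K + 1) ^ 2 * cnt E := by ring
    _ ≤ 6400 * (4 / 9 : ℝ) ^ freshScale r * cnt E := mul_le_mul_of_nonneg_right hratio hE0

/-- **The profile** `g(r)`: `1` for `r < 4`, `6400 (4/9)^{i⋆(r)}` for `r ≥ 4`. [folklore] -/
def gProf (r : ℕ) : ℝ≥0∞ := if r < 4 then 1 else ENNReal.ofReal (6400 * (4 / 9 : ℝ) ^ freshScale r)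

/-- **The decoupling inequality in the filtration** (hypothesis `hdec` of `SparseMeetingTails`),
for the counting measure on pairs with all sets measurable. [cite: BenjaminiPemantlePeres1998, Lemma 3.1 (variant)] -/
theorem count_inter_M_le (hK : m ≤ 2 ^ K) (s r : ℕ) (E : Set (Pair K m))
    (hE : MeasurableSet[filt K m s] E) :
    @Measure.count (Pair K m) ⊤ (E ∩ M K m (s + r)) ≤ gProf r * @Measure.count (Pair K m) ⊤ E := by
  by_cases hsr : s + r ≤ m
  · by_cases hr : r < 4
    · rw [gProf, if_pos hr, one_mul]
      exact measure_mono Set.inter_subset_left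
    · push Not at hr
      rw [gProf, if_neg (not_lt.2 hr), count_eq_cnt, count_eq_cnt]
      have h := cnt_inter_M_le hK hr hsr E (measurableSet_filt_iff.1 hE)
      have h6 : (0 : ℝ) ≤ 6400 * (4 / 9 : ℝ) ^ freshScale r := by positivity
      calc ((cnt (E ∩ M K m (s + r)) : ℕ) : ℝ≥0∞)
          = ENNReal.ofReal (cnt (E ∩ M K m (s + r)) : ℝ) := by rw [ENNReal.ofReal_natCast]
        _ ≤ ENNReal.ofReal (6400 * (4 / 9 : ℝ) ^ freshScale r * cnt E) := ENNReal.ofReal_le_ofReal h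
        _ = ENNReal.ofReal (6400 * (4 / 9 : ℝ) ^ freshScale r) * (cnt E : ℝ≥0∞) := by
          rw [ENNReal.ofReal_mul h6, ENNReal.ofReal_natCast]
  · have : M K m (s + r) = ∅ := by rw [M, if_neg hsr]
    rw [this, Set.inter_empty, measure_empty]
    exact bot_le

/-! ### Tail sums of the profile over dyadic shells -/

/-- The real tail sum: `∑_{2^{I+1} ≤ r < n} 6400 (4/9)^{i⋆(r)} ≤ 115200 (8/9)^I` (`I ≥ 1`):
the `r` with `i⋆(r) = i` number at most `2^{i+1}`. [folklore] -/
theorem sum_profile_le {I : ℕ} (hI : 1 ≤ I) (n : ℕ) :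
    ∑ r ∈ Finset.Ico (2 ^ (I + 1)) n, (6400 : ℝ) * (4 / 9 : ℝ) ^ freshScale r ≤
      115200 * (8 / 9 : ℝ) ^ I := by
  classical
  have hfib : ∀ i, #{r ∈ Finset.Ico (2 ^ (I + 1)) n | freshScale r = i} ≤ 2 ^ (i + 1) := by
    intro i
    have hsub : ({r ∈ Finset.Ico (2 ^ (I + 1)) n | freshScale r = i}) ⊆
        Finset.Ico (2 ^ (i + 1)) (2 ^ (i + 2)) := by
      intro r hr
      simp only [Finset.mem_filter, Finset.mem_Ico] at hr ⊢
      obtain ⟨⟨hr1, -⟩, hr2⟩ := hr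
      have hr4 : 4 ≤ r := le_trans (by
        calc (4 : ℕ) = 2 ^ 2 := by norm_num
          _ ≤ 2 ^ (I + 1) := Nat.pow_le_pow_right (by norm_num) (by omega)) hr1
      have hlog : 2 ≤ Nat.log 2 r := Nat.le_log_of_pow_le (by norm_num) (by simpa using hr4)
      have hl : Nat.log 2 r = i + 1 := by unfold freshScale at hr2; omega
      constructor
      · rw [← hl]; exact Nat.pow_log_le_self 2 (by omega)
      · have := Nat.lt_pow_succ_log_self (b := 2) (by norm_num) r
        rw [hl] at this
        exact this
    refine (Finset.card_le_card hsub).trans ?_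
    have : 2 ^ (i + 2) = 2 ^ (i + 1) + 2 ^ (i + 1) := by ring
    rw [Nat.card_Ico, this, Nat.add_sub_cancel]
  rw [Finset.sum_comp (fun i => (6400 : ℝ) * (4 / 9 : ℝ) ^ i) freshScale]
  have himg : (Finset.Ico (2 ^ (I + 1)) n).image freshScale ⊆ Finset.Ico I (I + n) := by
    intro i hi
    rw [Finset.mem_image] at hi
    obtain ⟨r, hr, rfl⟩ := hi
    rw [Finset.mem_Ico] at hr ⊢
    have hlog : I + 1 ≤ Nat.log 2 r := Nat.le_log_of_pow_le (by norm_num) hr.1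
    have hlt : Nat.log 2 r < n := lt_of_le_of_lt (Nat.log_le_self 2 r) hr.2
    unfold freshScale
    omega
  calc ∑ i ∈ (Finset.Ico (2 ^ (I + 1)) n).image freshScale,
        #{r ∈ Finset.Ico (2 ^ (I + 1)) n | freshScale r = i} • ((6400 : ℝ) * (4 / 9 : ℝ) ^ i)
      ≤ ∑ i ∈ (Finset.Ico (2 ^ (I + 1)) n).image freshScale, (12800 : ℝ) * (8 / 9 : ℝ) ^ i := by
        refine Finset.sum_le_sum fun i _ => ?_
        rw [nsmul_eq_mul]
        calc (#{r ∈ Finset.Ico (2 ^ (I + 1)) n | freshScale r = i} : ℝ) * (6400 * (4 / 9 : ℝ) ^ i)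
            ≤ (2 : ℝ) ^ (i + 1) * (6400 * (4 / 9 : ℝ) ^ i) := by
              refine mul_le_mul_of_nonneg_right ?_ (by positivity)
              exact_mod_cast hfib i
          _ = 12800 * (8 / 9 : ℝ) ^ i := by
              rw [pow_succ, show (8 / 9 : ℝ) = 2 * (4 / 9) by norm_num, mul_pow]; ring
    _ ≤ ∑ i ∈ Finset.Ico I (I + n), (12800 : ℝ) * (8 / 9 : ℝ) ^ i :=
        Finset.sum_le_sum_of_subset_of_nonneg himg fun i _ _ => by positivity
    _ = 12800 * ∑ i ∈ Finset.Ico I (I + n), (8 / 9 : ℝ) ^ i := by rw [Finset.mul_sum]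
    _ ≤ 12800 * ((8 / 9 : ℝ) ^ I / (1 - 8 / 9)) := by
        refine mul_le_mul_of_nonneg_left (geom_sum_Ico_le_of_lt_one (by norm_num) (by norm_num)) (by norm_num)
    _ = 115200 * (8 / 9 : ℝ) ^ I := by ring

/-- The tail sums of the profile in `ℝ≥0∞` (hypothesis `hG` of `SparseMeetingTails`). [folklore] -/
theorem sum_gProf_le {I : ℕ} (hI : 1 ≤ I) (n : ℕ) :
    ∑ r ∈ Finset.Ico (2 ^ (I + 1)) n, gProf r ≤ ENNReal.ofReal (115200 * (8 / 9 : ℝ) ^ I) := by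
  have h4 : ∀ r ∈ Finset.Ico (2 ^ (I + 1)) n, ¬ r < 4 := by
    intro r hr
    rw [Finset.mem_Ico] at hr
    have : (4 : ℕ) ≤ 2 ^ (I + 1) :=
      calc (4 : ℕ) = 2 ^ 2 := by norm_num
        _ ≤ 2 ^ (I + 1) := Nat.pow_le_pow_right (by norm_num) (by omega)
    omega
  calc ∑ r ∈ Finset.Ico (2 ^ (I + 1)) n, gProf r
      = ∑ r ∈ Finset.Ico (2 ^ (I + 1)) n, ENNReal.ofReal ((6400 : ℝ) * (4 / 9 : ℝ) ^ freshScale r) :=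
        Finset.sum_congr rfl fun r hr => by rw [gProf, if_neg (h4 r hr)]
    _ = ENNReal.ofReal (∑ r ∈ Finset.Ico (2 ^ (I + 1)) n, (6400 : ℝ) * (4 / 9 : ℝ) ^ freshScale r) :=
        (ENNReal.ofReal_sum_of_nonneg fun r _ => by positivity).symm
    _ ≤ ENNReal.ofReal (115200 * (8 / 9 : ℝ) ^ I) := ENNReal.ofReal_le_ofReal (sum_profile_le hI n)

/-- There is an absolute scale beyond which the profile's tail is at most `1/2`. [folklore] -/
theorem exists_scale_tail_le_half : ∃ I : ℕ, 1 ≤ I ∧ (115200 : ℝ) * (8 / 9 : ℝ) ^ I ≤ 1 / 2 := by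
  obtain ⟨n, hn⟩ := exists_pow_lt_of_lt_one (show (0 : ℝ) < 1 / 230400 by norm_num)
    (show (8 / 9 : ℝ) < 1 by norm_num)
  refine ⟨max n 1, le_max_right _ _, ?_⟩
  have : (8 / 9 : ℝ) ^ max n 1 ≤ (8 / 9 : ℝ) ^ n :=
    pow_le_pow_of_le_one (by norm_num) (by norm_num) (le_max_left _ _)
  linarith

/-! ### Exponential tails for the number of near-meetings -/

open Classical in
/-- **Exponential tails for near-meetings of two independent paths.** There is an absolute
constant `L ≥ 1` such that for all `K, m` with `m ≤ 2^K` and all `k`, the number of pairs of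
path-randomnesses with at least `k` near-meeting times in `[0, m]` is at most
`(1/2)^{⌊(k−1)/L⌋}` times the number of all pairs.
[cite: BenjaminiPemantlePeres1998, Lemma 3.1 and Theorem 1.3 (variant)] -/
theorem card_meetCount_ge_le : ∃ L : ℕ, 1 ≤ L ∧ ∀ (K m : ℕ), m ≤ 2 ^ K → ∀ k : ℕ,
    (cnt {p : Pair K m | k ≤ meetCount (M K m) 0 (m + 1) p} : ℝ) ≤
      (1 / 2 : ℝ) ^ ((k - 1) / L) * Fintype.card (Pair K m) := by
  obtain ⟨I, hI, hIle⟩ := exists_scale_tail_le_half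
  refine ⟨2 ^ (I + 1), Nat.one_le_two_pow, fun K m hK k => ?_⟩
  have hG : ∀ n, ∑ r ∈ Finset.Ico (2 ^ (I + 1)) n, gProf r ≤ ENNReal.ofReal (1 / 2) := fun n =>
    (sum_gProf_le hI n).trans (ENNReal.ofReal_le_ofReal hIle)
  have h := measure_meetCount_ge_le_pow_div (mΩ := ⊤) (@Measure.count (Pair K m) ⊤)
    (ℱ := filt K m) (M := M K m) (filt_mono K m) (fun _ => le_top) measurableSet_filt_M
    (count_inter_M_le hK) hG (m + 1) k
  rw [count_eq_cnt, count_eq_cnt, ← ENNReal.ofReal_natCast, ← ENNReal.ofReal_natCast,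
    ← ENNReal.ofReal_pow (by norm_num), ← ENNReal.ofReal_mul (by positivity)] at h
  have h' := (ENNReal.ofReal_le_ofReal_iff (by positivity)).1 h
  refine h'.trans (le_of_eq ?_)
  congr 1
  unfold cnt
  simp

end DyadicWalk

end Literature.Probability.LatticeModels
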